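import Literature.NumberTheory.EllipticCurves.EisensteinWeightOneFullRowContinuation
import Literature.NumberTheory.EllipticCurves.Gamma0EisensteinWeightOne
import Mathlib.NumberTheory.LSeries.HurwitzZetaOdd
import HarnessLib

/-!
# Hecke's congruence Eisenstein series of weight one and their continuation in `s`

Topic `Literature/NumberTheory/EllipticCurves`; namespace
`Literature.NumberTheory.EllipticCurves.ModularForms`. Definitions with bodies (`e1Plain`,
`congrSum`, `fullRowSeries`, `congrColumn`, `congrCont`) and theorems; no named fact.

For a level `M ≥ 1`, a residue class `v₀ = (c₀, d₀) ∈ ℤ²` (read mod `M`), `z ∈ ℍ` and `Re s > 1/2`,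
Hecke's congruence Eisenstein series of weight one is

  `G(z, s; v₀) = ∑_{v ≡ v₀ (M), v ≠ 0} (cz + d)⁻¹ (Im z/|cz + d|²)ˢ`,  `v = (c, d)`   (`congrSum`)

(the term at `v = 0` is `0`). Its rows `c = c₀ + M u` are: for `c = 0`, the odd Hurwitz zeta value
`2 yˢ M^{-1-2s} ζ_odd(d₀/M, 1 + 2s)` (`tsum_row_zero_eq`; Mathlib `hurwitzZetaOdd`); for `c ≠ 0`,
scaled full lattice rows `± yˢ M^{-1-2s} R₀((|c| z ± d₀)/M, s)` (`tsum_row_pos_eq`,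
`tsum_row_neg_eq`), and `R₀ = R̃₀ = -i I₂(s)(Im w)^{-2s} + Σ(w, s)`
(`EisensteinWeightOneFullRowContinuation.lean`; `Σ = fullRowSeries`). Summing the constant terms
over the columns gives another odd Hurwitz zeta value, `∑_{c ≡ c₀, c ≠ 0} sign(c) |c y/M|^{-2s}
= 2 y^{-2s} ζ_odd(c₀/M, 2s)`. Hence **for `Re s > 1/2`** (`congrSum_eq_congrCont`)

  `G(z, s; v₀) = yˢ M^{-1-2s} [ 𝟙[M ∣ c₀] 2 ζ_odd(d₀/M, 1+2s) - 2i I₂(s) y^{-2s} ζ_odd(c₀/M, 2s)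
                                + ∑_{u ∈ ℤ} Σ_col(u) ]`                                (`congrCont`)

with `Σ_col(u) = ± Σ((|c| z ± d₀)/M, s)`, `c = c₀ + Mu` (`congrColumn`). Both odd Hurwitz zeta
functions are ENTIRE (the poles of the two Hurwitz zeta functions at `2s = 1` cancel — weight one),
`I₂` and `Σ` are holomorphic on `Re s > -1/2`, and the column series converges absolutely there; so
`congrCont` is the continuation of `G(z, ·; v₀)` to `Re s > -1/2` (holomorphy and the polynomial
bounds in `y` are in the next file). This is Hecke 1927, §2 (the functions `G(τ, s; a₁, a₂, N)`),
with Poisson summation replaced by the duplication/Abel device of the previous files.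

## References

* E. Hecke, *Theorie der Eisensteinschen Reihen höherer Stufe…*, Abh. Math. Sem. Hamburg 5 (1927),
  §§1–2.
* B. Schoeneberg, *Elliptic Modular Functions*, Springer (1974), Ch. VII §2.
-/

noncomputable section

open Complex Real Set MeasureTheory Filter Finset HurwitzZeta
open scoped Topology ComplexConjugate UpperHalfPlane

namespace Literature.NumberTheory.EllipticCurves.ModularForms

/-! ### The objects -/

/-- The plain weight-one summand `(cz + d)⁻¹ (Im z/|cz + d|²)ˢ` (`0` at `v = 0`). [folklore] -/
def e1Plain (s : ℂ) (v : Fin 2 → ℤ) (z : ℍ) : ℂ :=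
  ((v 0 : ℂ) * z + v 1)⁻¹ * (((e1Base v z : ℝ)) : ℂ) ^ s

/-- **Hecke's congruence Eisenstein series of weight one**
`G(z, s; v₀) = ∑_{v ≡ v₀ (M), v ≠ 0} (cz + d)⁻¹ (Im z/|cz + d|²)ˢ` (a `tsum` over `ℤ²`; absolutely
convergent for `Re s > 1/2`). [folklore] -/
def congrSum (M : ℕ) (v₀ : Fin 2 → ℤ) (z : ℍ) (s : ℂ) : ℂ :=
  ∑' v : Fin 2 → ℤ, if (M : ℤ) ∣ v 0 - v₀ 0 ∧ (M : ℤ) ∣ v 1 - v₀ 1 then e1Plain s v z else 0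

/-- The series part `Σ(w, s) = ∑_{j ≥ 0} (2^{j+1})^{2s} R̃(χ_alt, 2^{j+1} w, s)` of the continued full
row `R̃₀ = -i I₂(s) (Im w)^{-2s} + Σ`. [folklore] -/
def fullRowSeries (w s : ℂ) : ℂ :=
  ∑' j : ℕ, ((2 ^ (j + 1) : ℕ) : ℂ) ^ (2 * s) * rowCont 2 altWeight (((2 ^ (j + 1) : ℕ) : ℂ) * w) s

/-- The column term `Σ_col(u) = ± Σ((|c| z ± d₀)/M, s)`, `c = c₀ + Mu` (`0` for `c = 0`). [folklore] -/
def congrColumn (M : ℕ) (v₀ : Fin 2 → ℤ) (z : ℍ) (s : ℂ) (u : ℤ) : ℂ :=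
  if 0 < v₀ 0 + M * u then
    fullRowSeries ((((v₀ 0 + M * u : ℤ) : ℂ) * z + ((v₀ 1 : ℤ) : ℂ)) / M) s
  else if v₀ 0 + M * u < 0 then
    -fullRowSeries ((((-(v₀ 0 + M * u) : ℤ) : ℂ) * z + ((-v₀ 1 : ℤ) : ℂ)) / M) s
  else 0

/-- **The continuation** of the congruence Eisenstein series:
`yˢ M^{-1-2s} [𝟙[M ∣ c₀] 2 ζ_odd(d₀/M, 1+2s) - 2i I₂(s) y^{-2s} ζ_odd(c₀/M, 2s) + ∑_u Σ_col(u)]`.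
[folklore] -/
def congrCont (M : ℕ) (v₀ : Fin 2 → ℤ) (z : ℍ) (s : ℂ) : ℂ :=
  ((z.im : ℝ) : ℂ) ^ s * (M : ℂ) ^ (-1 - 2 * s) *
    ((if (M : ℤ) ∣ v₀ 0 then
        2 * hurwitzZetaOdd (((v₀ 1 : ℝ) / (M : ℝ) : ℝ) : UnitAddCircle) (1 + 2 * s) else 0) +
      2 * (-I * constIntegral s) * ((z.im : ℝ) : ℂ) ^ (-2 * s) *
        hurwitzZetaOdd (((v₀ 0 : ℝ) / (M : ℝ) : ℝ) : UnitAddCircle) (2 * s) +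
      ∑' u : ℤ, congrColumn M v₀ z s u)

/-- `R̃₀ = -i I₂(s)(Im w)^{-2s} + Σ`. [folklore] -/
theorem fullRowCont_eq (w s : ℂ) :
    fullRowCont w s = -I * constIntegral s * ((w.im : ℝ) : ℂ) ^ (-2 * s) + fullRowSeries w s := rfl

/-! ### The plain summand -/

/-- `cz + d ≠ 0` for `(c, d) ≠ 0`. [folklore] -/
private theorem linear_ne_zero_of_ne_zero' {v : Fin 2 → ℤ} (hv : v ≠ 0) (z : ℍ) :
    (v 0 : ℂ) * z + v 1 ≠ 0 := by
  have hne : (fun i => (v i : ℝ)) ≠ 0 := by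
    intro h; apply hv; ext i
    have := congrFun h i
    simpa using this
  simpa using UpperHalfPlane.linear_ne_zero z hne

/-- The summand vanishes at `v = 0`. [folklore] -/
theorem e1Plain_zero (s : ℂ) (z : ℍ) : e1Plain s 0 z = 0 := by
  simp [e1Plain]

/-- **`e_{-v} = -e_v`** (weight one, no character). [folklore] -/
theorem e1Plain_neg (s : ℂ) (v : Fin 2 → ℤ) (z : ℍ) : e1Plain s (-v) z = -e1Plain s v z := by
  unfold e1Plain e1Base
  simp only [Pi.neg_apply, Int.cast_neg]
  rw [show -(v 0 : ℂ) * (z : ℂ) + -(v 1 : ℂ) = -((v 0 : ℂ) * z + v 1) by ring, norm_neg, inv_neg]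
  ring

/-- **On a row `c > 0`**: `e_{(c,d)}(z, s) = yˢ k(cz, s; d)`. [folklore] -/
theorem e1Plain_row_pos {c : ℤ} (hc : 0 < c) (s : ℂ) (d : ℤ) (z : ℍ) :
    e1Plain s ![c, d] z = ((z.im : ℝ) : ℂ) ^ s * rowKernel ((c : ℂ) * z) s d := by
  have hw : 0 < ((c : ℂ) * z).im := by
    rw [show ((c : ℂ)) = ((c : ℝ) : ℂ) by norm_cast, Complex.im_ofReal_mul (c : ℝ) (z : ℂ)]
    exact mul_pos (by exact_mod_cast hc) z.im_pos
  rw [rowKernel_eq_inv_mul_inv_cpow hw]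
  unfold e1Plain e1Base
  simp only [Matrix.cons_val_zero, Matrix.cons_val_one]
  have hL : (d : ℂ) + (c : ℂ) * z = (c : ℂ) * z + d := by ring
  rw [ofReal_intCast, hL, div_eq_mul_inv, ofReal_mul,
    mul_cpow_ofReal_nonneg z.im_pos.le (by positivity)]
  ring

/-- `((n²)⁻¹ : ℝ)ˢ = n^{-2s}` for a positive natural number `n`. [folklore] -/
private theorem ofReal_inv_sq_cpow' {r : ℕ} (hr : 0 < r) (s : ℂ) :
    ((((r : ℝ) ^ 2)⁻¹ : ℝ) : ℂ) ^ s = (r : ℂ) ^ (-2 * s) := by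
  have hr' : (0 : ℝ) < r := by exact_mod_cast hr
  have him : (log (r : ℂ)).im = 0 := by
    rw [← Complex.natCast_log]; exact Complex.ofReal_im _
  have hlog : (log (r : ℂ) * (-2)).im = 0 := by
    simp [Complex.mul_im, him]
  rw [cpow_mul s (by rw [hlog]; exact neg_lt_zero.mpr Real.pi_pos)
      (by rw [hlog]; exact Real.pi_pos.le),
    cpow_neg, show ((2 : ℂ)) = ((2 : ℕ) : ℂ) by norm_num, cpow_natCast]
  push_cast
  ring_nf

/-- **On the row `c = 0`**: `e_{(0,d)}(z, s) = yˢ d⁻¹ |d|^{-2s}` (`d ≠ 0`). [folklore] -/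
theorem e1Plain_row_zero (s : ℂ) {d : ℤ} (hd : d ≠ 0) (z : ℍ) :
    e1Plain s ![0, d] z = ((z.im : ℝ) : ℂ) ^ s * ((d : ℂ)⁻¹ * ((d.natAbs : ℕ) : ℂ) ^ (-2 * s)) := by
  have hn : 0 < d.natAbs := Int.natAbs_pos.mpr hd
  unfold e1Plain e1Base
  simp only [Matrix.cons_val_zero, Matrix.cons_val_one, Int.cast_zero, zero_mul, zero_add,
    Complex.norm_intCast]
  have habs : |(d : ℝ)| = (d.natAbs : ℝ) := by
    rw [Nat.cast_natAbs, Int.cast_abs]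
  rw [habs, div_eq_mul_inv (z.im), ofReal_mul, mul_cpow_ofReal_nonneg z.im_pos.le (by positivity),
    ofReal_inv_sq_cpow' hn]
  ring

/-! ### Absolute convergence on `Re s > 1/2` -/

/-- The summand bound `‖e_v(z, s)‖ ≤ y^σ r(z)^{-1-2σ} ‖v‖^{-1-2σ}` (`v ≠ 0`, `σ ≥ -1/2`).
[folklore] -/
theorem norm_e1Plain_le {v : Fin 2 → ℤ} (hv : v ≠ 0) {s : ℂ} (hs : -1 / 2 ≤ s.re) (z : ℍ) :
    ‖e1Plain s v z‖ ≤ z.im ^ s.re * (EisensteinSeries.r z ^ (-(1 + 2 * s.re)) *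
      ‖v‖ ^ (-(1 + 2 * s.re))) := by
  have hL : 0 < ‖(v 0 : ℂ) * z + v 1‖ := norm_pos_iff.mpr (linear_ne_zero_of_ne_zero' hv z)
  have hb : 0 < e1Base v z := div_pos z.im_pos (pow_pos hL 2)
  have h1 : ‖e1Plain s v z‖ = ‖(v 0 : ℂ) * z + v 1‖⁻¹ * (e1Base v z) ^ s.re := by
    unfold e1Plain
    rw [norm_mul, norm_inv, Complex.norm_cpow_eq_rpow_re_of_pos hb]
  rw [h1]
  have h3 : ‖(v 0 : ℂ) * z + v 1‖⁻¹ * (e1Base v z) ^ s.re =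
      z.im ^ s.re * ‖(v 0 : ℂ) * z + v 1‖ ^ (-(1 + 2 * s.re)) := by
    have h2' : (‖(v 0 : ℂ) * z + v 1‖ ^ 2) ^ s.re = ‖(v 0 : ℂ) * z + v 1‖ ^ (2 * s.re) := by
      rw [← Real.rpow_natCast, ← Real.rpow_mul hL.le]; norm_num
    unfold e1Base
    rw [Real.div_rpow z.im_pos.le (by positivity), h2',
      show -(1 + 2 * s.re) = (-1) + (-(2 * s.re)) by ring, Real.rpow_add hL,
      Real.rpow_neg hL.le (2 * s.re), Real.rpow_neg_one, div_eq_mul_inv]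
    ring
  rw [h3]
  exact mul_le_mul_of_nonneg_left (EisensteinSeries.summand_bound z (k := 1 + 2 * s.re)
    (by linarith) v) (by positivity)

/-- **Summability of `v ↦ e_v(z, s)` over `ℤ²` for `Re s > 1/2`.** [folklore] -/
theorem summable_e1Plain {s : ℂ} (hs : 1 / 2 < s.re) (z : ℍ) :
    Summable fun v : Fin 2 → ℤ ↦ e1Plain s v z := by
  have hmaj : Summable fun v : Fin 2 → ℤ ↦ z.im ^ s.re *
      (EisensteinSeries.r z ^ (-(1 + 2 * s.re)) * ‖v‖ ^ (-(1 + 2 * s.re))) :=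
    ((EisensteinSeries.summable_one_div_norm_rpow (k := 1 + 2 * s.re) (by linarith)).mul_left
      _).mul_left _
  have hnn : ∀ v : Fin 2 → ℤ, 0 ≤ z.im ^ s.re *
      (EisensteinSeries.r z ^ (-(1 + 2 * s.re)) * ‖v‖ ^ (-(1 + 2 * s.re))) := fun v ↦
    mul_nonneg (Real.rpow_nonneg z.im_pos.le _) (mul_nonneg
      (Real.rpow_nonneg (EisensteinSeries.r_pos z).le _) (Real.rpow_nonneg (norm_nonneg _) _))
  refine Summable.of_norm_bounded hmaj fun v ↦ ?_
  rcases eq_or_ne v 0 with rfl | hv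
  · rw [e1Plain_zero, norm_zero]; exact hnn 0
  · exact norm_e1Plain_le hv (by linarith) z

/-! ### The class `v ≡ v₀` as `v₀ + M u`, `u ∈ ℤ²` -/

section Reparam

variable {M : ℕ} (hM : 0 < M) (v₀ : Fin 2 → ℤ)
include hM

/-- The parametrisation `u ↦ v₀ + M u` of the class of `v₀`. [folklore] -/
theorem injective_class_param :
    Function.Injective (fun p : ℤ × ℤ ↦ (![v₀ 0 + M * p.1, v₀ 1 + M * p.2] : Fin 2 → ℤ)) := by
  intro p q h
  have h0 := congrFun h 0
  have h1 := congrFun h 1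
  simp only [Matrix.cons_val_zero, Matrix.cons_val_one] at h0 h1
  have hM' : (M : ℤ) ≠ 0 := by exact_mod_cast hM.ne'
  exact Prod.ext (mul_left_cancel₀ hM' (by linarith)) (mul_left_cancel₀ hM' (by linarith))

/-- **`G(z, s; v₀) = ∑_{u ∈ ℤ²} e_{v₀ + Mu}(z, s)`** (no convergence needed). [folklore] -/
theorem congrSum_eq_tsum_prod (z : ℍ) (s : ℂ) :
    congrSum M v₀ z s = ∑' p : ℤ × ℤ, e1Plain s ![v₀ 0 + M * p.1, v₀ 1 + M * p.2] z := by
  set g : ℤ × ℤ → (Fin 2 → ℤ) := fun p ↦ ![v₀ 0 + M * p.1, v₀ 1 + M * p.2] with hg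
  have hinj : Function.Injective g := injective_class_param hM v₀
  have hsupp : Function.support (fun v : Fin 2 → ℤ ↦
      if (M : ℤ) ∣ v 0 - v₀ 0 ∧ (M : ℤ) ∣ v 1 - v₀ 1 then e1Plain s v z else 0) ⊆ Set.range g := by
    intro v hv
    rw [Function.mem_support] at hv
    by_cases h : (M : ℤ) ∣ v 0 - v₀ 0 ∧ (M : ℤ) ∣ v 1 - v₀ 1
    · obtain ⟨⟨a, ha⟩, ⟨b, hb⟩⟩ := h
      refine ⟨(a, b), ?_⟩
      simp only [hg]
      ext i; fin_cases i
      · simp; linarith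
      · simp; linarith
    · exact absurd (if_neg h) hv
  unfold congrSum
  rw [← hinj.tsum_eq hsupp]
  refine tsum_congr fun p ↦ ?_
  simp only [hg, Matrix.cons_val_zero, Matrix.cons_val_one]
  rw [if_pos ⟨⟨p.1, by ring⟩, ⟨p.2, by ring⟩⟩]

/-- Summability of the reparametrised family (`Re s > 1/2`). [folklore] -/
theorem summable_class_param {s : ℂ} (hs : 1 / 2 < s.re) (z : ℍ) :
    Summable fun p : ℤ × ℤ ↦ e1Plain s ![v₀ 0 + M * p.1, v₀ 1 + M * p.2] z :=
  (summable_e1Plain hs z).comp_injective (injective_class_param hM v₀)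

end Reparam

/-! ### The rows -/

section Rows

variable {M : ℕ} (hM : 0 < M) (v₀ : Fin 2 → ℤ) (z : ℍ)
include hM

omit hM in
/-- The base point of the row `c`: `w_c = (c z + d₀)/M` has `Im w_c = c y/M`. [folklore] -/
theorem im_rowBase (c d : ℤ) : ((((c : ℂ)) * z + d) / M).im = c * z.im / M := by
  rw [Complex.div_natCast_im, Complex.add_im, Complex.intCast_im, add_zero,
    show ((c : ℂ)) = ((c : ℝ) : ℂ) by norm_cast, Complex.im_ofReal_mul]
  rfl

/-- **A row `c > 0`**: `∑_u e_{(c, d₀ + Mu)} = yˢ M^{-1-2s} R₀((cz + d₀)/M, s)` (`Re s > 0`).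
[folklore] -/
theorem tsum_row_pos_eq {c : ℤ} (hc : 0 < c) (d₀ : ℤ) (s : ℂ) :
    ∑' u : ℤ, e1Plain s ![c, d₀ + M * u] z =
      ((z.im : ℝ) : ℂ) ^ s * ((M : ℂ) ^ (-1 - 2 * s) * fullRow ((((c : ℂ)) * z + d₀) / M) s) := by
  have hw : 0 < (((c : ℂ)) * z).im := by
    rw [show ((c : ℂ)) = ((c : ℝ) : ℂ) by norm_cast, Complex.im_ofReal_mul]
    exact mul_pos (by exact_mod_cast hc) z.im_pos
  unfold fullRow
  rw [← tsum_mul_left, ← tsum_mul_left]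
  refine tsum_congr fun u ↦ ?_
  rw [e1Plain_row_pos hc s _ z, rowKernel_class_eq hM hw s d₀ u]

/-- **A row `c < 0`**: `∑_u e_{(c, d₀ + Mu)} = -yˢ M^{-1-2s} R₀((|c| z - d₀)/M, s)` (`Re s > 0`).
[folklore] -/
theorem tsum_row_neg_eq {c : ℤ} (hc : c < 0) (d₀ : ℤ) (s : ℂ) :
    ∑' u : ℤ, e1Plain s ![c, d₀ + M * u] z =
      -(((z.im : ℝ) : ℂ) ^ s * ((M : ℂ) ^ (-1 - 2 * s) *
        fullRow ((((-c : ℤ) : ℂ) * z + ((-d₀ : ℤ) : ℂ)) / M) s)) := by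
  have hc' : 0 < -c := by linarith
  rw [← tsum_row_pos_eq hM z hc' (-d₀) s, ← tsum_neg, ← (Equiv.neg ℤ).tsum_eq]
  refine tsum_congr fun u ↦ ?_
  rw [← e1Plain_neg]
  congr 1
  ext i; fin_cases i
  · simp
  · simp [Equiv.neg]; ring

/-- The `c = 0` row, term by term, against Mathlib's odd Hurwitz zeta summand:
`e_{(0, d₀ + Mu)}(z, s) = yˢ M^{-1-2s} · 2 · [sign(u + b)/|u + b|^{1+2s}/2]`, `b = d₀/M`. [folklore] -/
theorem e1Plain_row_zero_eq_hurwitz_term (d₀ : ℤ) (s : ℂ) (u : ℤ) :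
    e1Plain s ![0, d₀ + M * u] z = ((z.im : ℝ) : ℂ) ^ s * ((M : ℂ) ^ (-1 - 2 * s) *
      (2 * (SignType.sign ((u : ℝ) + (d₀ : ℝ) / (M : ℝ)) /
        ((|(u : ℝ) + (d₀ : ℝ) / (M : ℝ)| : ℝ) : ℂ) ^ (1 + 2 * s) / 2))) := by
  have hM' : (0 : ℝ) < M := by exact_mod_cast hM
  have hM0 : (M : ℂ) ≠ 0 := by exact_mod_cast hM.ne'
  set d : ℤ := d₀ + M * u with hd
  -- `d = M (u + b)` as real numbers
  have hdr : (d : ℝ) = M * ((u : ℝ) + (d₀ : ℝ) / (M : ℝ)) := by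
    rw [hd]; push_cast; field_simp; ring
  rcases eq_or_ne d 0 with h0 | h0
  · -- both sides vanish
    have hub : (u : ℝ) + (d₀ : ℝ) / (M : ℝ) = 0 := by
      have : (d : ℝ) = 0 := by exact_mod_cast h0
      rw [hdr] at this
      rcases mul_eq_zero.mp this with h | h
      · exact absurd h hM'.ne'
      · exact h
    rw [h0, hub]
    simp [e1Plain, e1Base]
  · have hub : (u : ℝ) + (d₀ : ℝ) / (M : ℝ) ≠ 0 := by
      intro h; apply h0
      have : (d : ℝ) = 0 := by rw [hdr, h, mul_zero]
      exact_mod_cast this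
    rw [e1Plain_row_zero s h0 z]
    congr 1
    -- `d⁻¹ |d|^{-2s} = M^{-1-2s} sign(u+b) |u+b|^{-1-2s}`
    set t : ℝ := (u : ℝ) + (d₀ : ℝ) / (M : ℝ) with ht
    have htabs : 0 < |t| := abs_pos.mpr hub
    have hnat : ((d.natAbs : ℕ) : ℂ) = ((M * |t| : ℝ) : ℂ) := by
      have h1 : ((d.natAbs : ℕ) : ℝ) = |(d : ℝ)| := by
        rw [Nat.cast_natAbs, Int.cast_abs]
      rw [show ((d.natAbs : ℕ) : ℂ) = (((d.natAbs : ℕ) : ℝ) : ℂ) by norm_cast, h1, hdr, abs_mul,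
        abs_of_pos hM']
    have hdc : (d : ℂ) = ((M * t : ℝ) : ℂ) := by
      rw [show ((d : ℂ)) = ((d : ℝ) : ℂ) by norm_cast, hdr]
    -- `t⁻¹ = sign t · |t|⁻¹` and `sign t` as a real/complex number
    have htinvR : (t : ℝ)⁻¹ = (SignType.sign t : ℝ) * |t|⁻¹ := by
      rcases lt_or_gt_of_ne hub with h | h
      · rw [sign_neg h, abs_of_neg h, inv_neg]; simp
      · rw [sign_pos h, abs_of_pos h]; simp
    have hsignC : ((SignType.sign t : ℂ)) = (((SignType.sign t : ℝ)) : ℂ) := by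
      rcases lt_trichotomy t 0 with h | h | h
      · rw [sign_neg h]; simp
      · exact absurd h hub
      · rw [sign_pos h]; simp
    rw [hnat, hdc, show ((M * |t| : ℝ) : ℂ) = (M : ℂ) * ((|t| : ℝ) : ℂ) by push_cast; ring,
      natCast_mul_cpow_of_pos hM (by exact_mod_cast htabs.ne') (-2 * s)]
    have htC : ((|t| : ℝ) : ℂ) ≠ 0 := by exact_mod_cast htabs.ne'
    rw [div_eq_mul_inv _ (((|t| : ℝ) : ℂ) ^ (1 + 2 * s)), ← cpow_neg,
      show (-(1 + 2 * s)) = (-1 : ℂ) + (-2 * s) by ring, cpow_add _ _ htC, cpow_neg_one,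
      show (-1 - 2 * s) = (-1 : ℂ) + (-2 * s) by ring, cpow_add _ _ hM0, cpow_neg_one]
    rw [show ((SignType.sign ((u : ℝ) + (d₀ : ℝ) / (M : ℝ)) : ℂ)) = ((SignType.sign t : ℂ)) by
      rw [ht], hsignC]
    have htinv : (((M * t : ℝ)) : ℂ)⁻¹ = (M : ℂ)⁻¹ * (((SignType.sign t : ℝ) : ℂ) *
        (((|t| : ℝ) : ℂ))⁻¹) := by
      rw [show (((M * t : ℝ)) : ℂ) = (M : ℂ) * ((t : ℝ) : ℂ) by push_cast; ring, mul_inv,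
        ← ofReal_inv, htinvR]
      push_cast
      ring
    rw [htinv]
    ring

/-- **The row `c = 0`**: `∑_u e_{(0, d₀ + Mu)}(z, s) = yˢ M^{-1-2s} · 2 ζ_odd(d₀/M, 1 + 2s)`
(`Re s > 0`; Mathlib `hasSum_int_hurwitzZetaOdd`). [folklore] -/
theorem tsum_row_zero_eq (d₀ : ℤ) {s : ℂ} (hs : 0 < s.re) :
    ∑' u : ℤ, e1Plain s ![0, d₀ + M * u] z = ((z.im : ℝ) : ℂ) ^ s * ((M : ℂ) ^ (-1 - 2 * s) *
      (2 * hurwitzZetaOdd ((d₀ : ℝ) / (M : ℝ)) (1 + 2 * s))) := by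
  have h1s : 1 < (1 + 2 * s).re := by simp; linarith
  have h := (hasSum_int_hurwitzZetaOdd ((d₀ : ℝ) / (M : ℝ)) h1s).mul_left
    (((z.im : ℝ) : ℂ) ^ s * ((M : ℂ) ^ (-1 - 2 * s) * 2))
  have h' : HasSum (fun u : ℤ ↦ e1Plain s ![0, d₀ + M * u] z)
      (((z.im : ℝ) : ℂ) ^ s * ((M : ℂ) ^ (-1 - 2 * s) * 2) * hurwitzZetaOdd ((d₀ : ℝ) / (M : ℝ)) (1 + 2 * s)) := by
    refine h.congr_fun fun u ↦ ?_
    rw [e1Plain_row_zero_eq_hurwitz_term hM z d₀ s u]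
    ring
  rw [h'.tsum_eq]
  ring

end Rows

/-! ### The rows assembled: `Re s > 1/2` -/

section Assembly

variable {M : ℕ} (hM : 0 < M) (v₀ : Fin 2 → ℤ) (z : ℍ)
include hM

/-- The constant-term column: `u ↦ sign(c) (-i I₂(s)) (|c| y/M)^{-2s}`, `c = c₀ + Mu`, written
against Mathlib's odd Hurwitz zeta summand at `2s` with shift `a = c₀/M`
(`|c| y/M = |u + a| y`). [folklore] -/
theorem constColumn_eq_hurwitz_term (s : ℂ) (u : ℤ) :
    (if 0 < v₀ 0 + M * u then -I * constIntegral s *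
        (((((((v₀ 0 + M * u : ℤ)) : ℂ) * z + v₀ 1) / M).im : ℝ) : ℂ) ^ (-2 * s)
      else if v₀ 0 + M * u < 0 then -(-I * constIntegral s *
        ((((((-(v₀ 0 + M * u) : ℤ) : ℂ) * z + ((-v₀ 1 : ℤ) : ℂ)) / M).im : ℝ) : ℂ) ^ (-2 * s))
      else 0) =
      2 * (-I * constIntegral s) * ((z.im : ℝ) : ℂ) ^ (-2 * s) *
        (SignType.sign ((u : ℝ) + (v₀ 0 : ℝ) / (M : ℝ)) /
          ((|(u : ℝ) + (v₀ 0 : ℝ) / (M : ℝ)| : ℝ) : ℂ) ^ (2 * s) / 2) := by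
  have hM' : (0 : ℝ) < M := by exact_mod_cast hM
  set c : ℤ := v₀ 0 + M * u with hc
  set t : ℝ := (u : ℝ) + (v₀ 0 : ℝ) / (M : ℝ) with ht
  have hcr : (c : ℝ) = M * t := by rw [hc, ht]; push_cast; field_simp; ring
  have himc : ∀ (e d : ℤ), ((((e : ℂ)) * z + ((d : ℤ) : ℂ)) / M).im = e * z.im / M :=
    fun e d ↦ im_rowBase z e d
  rcases lt_trichotomy c 0 with hneg | hzero | hpos
  · have ht0 : t < 0 := by
      have : (c : ℝ) < 0 := by exact_mod_cast hneg
      rw [hcr] at this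
      nlinarith
    rw [if_neg (not_lt.mpr hneg.le), if_pos hneg, sign_neg ht0]
    rw [himc (-c) (-v₀ 1)]
    have habs : |t| = -t := abs_of_neg ht0
    have him_eq : ((-c : ℤ) : ℝ) * z.im / M = |t| * z.im := by
      rw [habs]; push_cast; rw [hcr]; field_simp
    rw [him_eq, ofReal_mul, mul_cpow_ofReal_nonneg (abs_nonneg t) z.im_pos.le,
      div_eq_mul_inv _ (((|t| : ℝ) : ℂ) ^ (2 * s)), ← cpow_neg, show -(2 * s) = -2 * s by ring]
    push_cast
    simp only [SignType.coe_one]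
    ring
  · have ht0 : t = 0 := by
      have : (c : ℝ) = 0 := by exact_mod_cast hzero
      rw [hcr] at this
      rcases mul_eq_zero.mp this with h | h
      · exact absurd h hM'.ne'
      · exact h
    rw [if_neg (not_lt.mpr hzero.le), if_neg (not_lt.mpr hzero.ge), ht0]
    simp
  · have ht0 : 0 < t := by
      have : (0 : ℝ) < c := by exact_mod_cast hpos
      rw [hcr] at this
      exact pos_of_mul_pos_right this hM'.le
    rw [if_pos hpos, sign_pos ht0]
    rw [himc c (v₀ 1)]
    have habs : |t| = t := abs_of_pos ht0
    have him_eq : (c : ℝ) * z.im / M = |t| * z.im := by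
      rw [habs, hcr]; field_simp
    rw [him_eq, ofReal_mul, mul_cpow_ofReal_nonneg (abs_nonneg t) z.im_pos.le,
      div_eq_mul_inv _ (((|t| : ℝ) : ℂ) ^ (2 * s)), ← cpow_neg, show -(2 * s) = -2 * s by ring]
    simp only [SignType.coe_one]
    ring

/-- The norm of the column term: `‖Σ_col(u)‖ ≤ (160/3)(1+‖s‖)² e^{2π|Im s|} I(3+2σ) (|c| y/M)^{-2-2σ}`
(`c = c₀ + Mu ≠ 0`; `0` for `c = 0`), `Re s > -1`. [folklore] -/
theorem norm_congrColumn_le {s : ℂ} (hs : -1 < s.re) (u : ℤ) :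
    ‖congrColumn M v₀ z s u‖ ≤ 160 * (1 + ‖s‖) ^ 2 * Real.exp (2 * π * |s.im|) *
      (∫ v : ℝ, (1 + v ^ 2) ^ (-(3 + 2 * s.re) / 2)) * (1 / 3) *
        (if v₀ 0 + M * u = 0 then 0 else
          ((|((v₀ 0 + M * u : ℤ) : ℝ)| * z.im / M) ^ (-2 - 2 * s.re))) := by
  have hM' : (0 : ℝ) < M := by exact_mod_cast hM
  set c : ℤ := v₀ 0 + M * u with hc
  have himc : ∀ (e d : ℤ), ((((e : ℂ)) * z + ((d : ℤ) : ℂ)) / M).im = e * z.im / M :=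
    fun e d ↦ im_rowBase z e d
  have hD0 : 0 ≤ 160 * (1 + ‖s‖) ^ 2 * Real.exp (2 * π * |s.im|) *
      (∫ v : ℝ, (1 + v ^ 2) ^ (-(3 + 2 * s.re) / 2)) * (1 / 3) := by
    have : 0 ≤ ∫ v : ℝ, (1 + v ^ 2) ^ (-(3 + 2 * s.re) / 2) :=
      integral_nonneg fun v ↦ Real.rpow_nonneg (by positivity) _
    positivity
  unfold congrColumn
  rcases lt_trichotomy c 0 with hneg | hzero | hpos
  · rw [if_neg (not_lt.mpr hneg.le), if_pos hneg, if_neg hneg.ne, norm_neg]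
    have hw : 0 < (((((-c : ℤ)) : ℂ) * z + ((-v₀ 1 : ℤ) : ℂ)) / M).im := by
      rw [himc]; push_cast
      exact div_pos (mul_pos (by exact_mod_cast (by linarith : 0 < -c)) z.im_pos) hM'
    have h := norm_tsum_scaled_rowCont_altWeight_le hw hs
    rw [himc] at h
    have habs : |(c : ℝ)| = ((-c : ℤ) : ℝ) := by
      rw [abs_of_neg (by exact_mod_cast hneg)]; push_cast; ring
    rw [habs]
    unfold fullRowSeries
    refine h.trans (le_of_eq ?_)
    ring
  · rw [if_neg (not_lt.mpr hzero.le), if_neg (not_lt.mpr hzero.ge), if_pos hzero, norm_zero,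
      mul_zero]
  · rw [if_pos hpos, if_neg hpos.ne']
    have hw : 0 < (((((c : ℤ)) : ℂ) * z + ((v₀ 1 : ℤ) : ℂ)) / M).im := by
      rw [himc]
      exact div_pos (mul_pos (by exact_mod_cast hpos) z.im_pos) hM'
    have h := norm_tsum_scaled_rowCont_altWeight_le hw hs
    rw [himc] at h
    have habs : |(c : ℝ)| = (c : ℝ) := abs_of_pos (by exact_mod_cast hpos)
    rw [habs]
    unfold fullRowSeries
    refine (le_of_eq ?_).trans (h.trans (le_of_eq ?_))
    · rfl
    · ring

/-- `∑_{u : c ≠ 0} |c₀ + Mu|^{-p} < ∞` for `p > 1`. [folklore] -/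
theorem summable_abs_class_rpow_neg {p : ℝ} (hp : 1 < p) :
    Summable fun u : ℤ ↦ (if v₀ 0 + M * u = 0 then (0 : ℝ) else
      |((v₀ 0 + M * u : ℤ) : ℝ)| ^ (-p)) := by
  have hM' : (0 : ℝ) < M := by exact_mod_cast hM
  have h := ((Real.summable_one_div_int_add_rpow ((v₀ 0 : ℝ) / (M : ℝ)) p).mpr hp).mul_left
    ((M : ℝ) ^ (-p))
  refine Summable.of_nonneg_of_le (fun u ↦ ?_) (fun u ↦ ?_) h
  · split_ifs
    · exact le_rfl
    · exact Real.rpow_nonneg (abs_nonneg _) _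
  · split_ifs with h0
    · exact mul_nonneg (Real.rpow_nonneg hM'.le _) (by positivity)
    · have hcr : ((v₀ 0 + M * u : ℤ) : ℝ) = M * ((u : ℝ) + (v₀ 0 : ℝ) / (M : ℝ)) := by
        push_cast; field_simp; ring
      rw [hcr, abs_mul, abs_of_pos hM', Real.mul_rpow hM'.le (abs_nonneg _),
        Real.rpow_neg (abs_nonneg _), one_div]

/-- Summability of the column series for `Re s > -1/2`. [folklore] -/
theorem summable_congrColumn {s : ℂ} (hs : -1 / 2 < s.re) :
    Summable fun u : ℤ ↦ congrColumn M v₀ z s u := by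
  have hM' : (0 : ℝ) < M := by exact_mod_cast hM
  have hy : 0 < z.im / M := div_pos z.im_pos hM'
  refine Summable.of_norm_bounded ?_ (fun u ↦ norm_congrColumn_le hM v₀ z (by linarith) u)
  refine Summable.mul_left _ ?_
  have h := (summable_abs_class_rpow_neg hM v₀ (p := 2 + 2 * s.re) (by linarith)).mul_left
    ((z.im / M) ^ (-2 - 2 * s.re))
  refine h.congr fun u ↦ ?_
  split_ifs with h0
  · simp
  · have habs : 0 < |((v₀ 0 + M * u : ℤ) : ℝ)| := abs_pos.mpr (by exact_mod_cast h0)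
    rw [show |((v₀ 0 + M * u : ℤ) : ℝ)| * z.im / M = |((v₀ 0 + M * u : ℤ) : ℝ)| * (z.im / M) by ring,
      Real.mul_rpow habs.le hy.le, show -(2 + 2 * s.re) = -2 - 2 * s.re by ring]
    ring

/-- **`G(z, s; v₀) = congrCont(z, s; v₀)` for `Re s > 1/2`.** [folklore] -/
theorem congrSum_eq_congrCont {s : ℂ} (hs : 1 / 2 < s.re) :
    congrSum M v₀ z s = congrCont M v₀ z s := by
  have hM' : (0 : ℝ) < M := by exact_mod_cast hM
  have hs0 : 0 < s.re := by linarith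
  have h2s : 1 < (2 * s).re := by simp; linarith
  have hsum := summable_class_param hM v₀ hs z
  rw [congrSum_eq_tsum_prod hM v₀ z s, hsum.tsum_prod]
  -- the row `u₁`, with `c = c₀ + M u₁`
  set Y : ℂ := ((z.im : ℝ) : ℂ) ^ s * (M : ℂ) ^ (-1 - 2 * s) with hY
  -- the three pieces of each row
  set Zf : ℤ → ℂ := fun u ↦ if v₀ 0 + M * u = 0 then
    2 * hurwitzZetaOdd ((v₀ 1 : ℝ) / (M : ℝ)) (1 + 2 * s) else 0 with hZf
  set Af : ℤ → ℂ := fun u ↦ 2 * (-I * constIntegral s) * ((z.im : ℝ) : ℂ) ^ (-2 * s) *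
    (SignType.sign ((u : ℝ) + (v₀ 0 : ℝ) / (M : ℝ)) /
      ((|(u : ℝ) + (v₀ 0 : ℝ) / (M : ℝ)| : ℝ) : ℂ) ^ (2 * s) / 2) with hAf
  have hrow : ∀ u : ℤ, ∑' u₂ : ℤ, e1Plain s ![v₀ 0 + M * u, v₀ 1 + M * u₂] z =
      Y * (Zf u + Af u + congrColumn M v₀ z s u) := by
    intro u
    have hA := constColumn_eq_hurwitz_term hM v₀ z s u
    simp only [hZf, hAf, hY]
    rw [← hA]
    rcases lt_trichotomy (v₀ 0 + M * u) 0 with hneg | hzero | hpos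
    · -- negative row
      have hw : 0 < (((((-(v₀ 0 + M * u) : ℤ)) : ℂ) * z + ((-(v₀ 1) : ℤ) : ℂ)) / M).im := by
        rw [im_rowBase z]
        exact div_pos (mul_pos (by exact_mod_cast (by linarith : 0 < -(v₀ 0 + M * u)))
          z.im_pos) hM'
      rw [tsum_row_neg_eq hM z hneg (v₀ 1) s, fullRow_eq_fullRowCont hw hs0, fullRowCont_eq,
        if_neg (not_lt.mpr hneg.le), if_pos hneg, if_neg hneg.ne]
      unfold congrColumn
      rw [if_neg (not_lt.mpr hneg.le), if_pos hneg]
      unfold fullRowSeries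
      ring
    · -- the row `c = 0`
      have h1 : ¬(0 < v₀ 0 + (M : ℤ) * u) := by rw [hzero]; exact lt_irrefl 0
      have h2 : ¬(v₀ 0 + (M : ℤ) * u < 0) := by rw [hzero]; exact lt_irrefl 0
      rw [show (fun u₂ : ℤ ↦ e1Plain s ![v₀ 0 + M * u, v₀ 1 + M * u₂] z) =
          fun u₂ : ℤ ↦ e1Plain s ![0, v₀ 1 + M * u₂] z by funext u₂; rw [hzero],
        tsum_row_zero_eq hM z (v₀ 1) hs0, if_neg h1, if_neg h2, if_pos hzero]
      unfold congrColumn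
      rw [if_neg h1, if_neg h2]
      ring
    · -- positive row
      have hw : 0 < ((((((v₀ 0 + M * u) : ℤ)) : ℂ) * z + ((v₀ 1 : ℤ) : ℂ)) / M).im := by
        rw [im_rowBase z]
        exact div_pos (mul_pos (by exact_mod_cast hpos) z.im_pos) hM'
      rw [tsum_row_pos_eq hM z hpos (v₀ 1) s,
        fullRow_eq_fullRowCont hw hs0, fullRowCont_eq, if_pos hpos, if_neg hpos.ne']
      unfold congrColumn
      rw [if_pos hpos]
      unfold fullRowSeries
      ring
  simp_rw [hrow]
  rw [tsum_mul_left]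
  -- summability of the three pieces
  have hZ : HasSum Zf (if (M : ℤ) ∣ v₀ 0 then 2 * hurwitzZetaOdd ((v₀ 1 : ℝ) / (M : ℝ)) (1 + 2 * s)
      else 0) := by
    by_cases hdvd : (M : ℤ) ∣ v₀ 0
    · obtain ⟨q, hq⟩ := hdvd
      rw [if_pos ⟨q, hq⟩]
      have hZ' : Zf = fun u ↦ if u = -q then 2 * hurwitzZetaOdd ((v₀ 1 : ℝ) / (M : ℝ)) (1 + 2 * s)
          else 0 := by
        funext u
        simp only [hZf]
        have : v₀ 0 + M * u = 0 ↔ u = -q := by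
          rw [hq]
          constructor
          · intro h
            have hM0 : (M : ℤ) ≠ 0 := by exact_mod_cast hM.ne'
            have : (M : ℤ) * (u + q) = 0 := by linarith
            rcases mul_eq_zero.mp this with h1 | h1
            · exact absurd h1 hM0
            · linarith
          · intro h; rw [h]; ring
        simp only [this]
      rw [hZ']
      exact hasSum_ite_eq (-q) _
    · rw [if_neg hdvd]
      have hZ' : Zf = fun _ ↦ 0 := by
        funext u
        simp only [hZf]
        rw [if_neg]
        intro h
        exact hdvd ⟨-u, by linarith⟩
      rw [hZ']
      exact hasSum_zero
  have hA : HasSum Af (2 * (-I * constIntegral s) * ((z.im : ℝ) : ℂ) ^ (-2 * s) *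
      hurwitzZetaOdd ((v₀ 0 : ℝ) / (M : ℝ)) (2 * s)) :=
    (hasSum_int_hurwitzZetaOdd ((v₀ 0 : ℝ) / (M : ℝ)) h2s).mul_left _
  have hC : Summable fun u : ℤ ↦ congrColumn M v₀ z s u := summable_congrColumn hM v₀ z (by linarith)
  rw [(hZ.summable.add hA.summable).tsum_add hC, hZ.summable.tsum_add hA.summable, hZ.tsum_eq,
    hA.tsum_eq, hY]
  unfold congrCont
  ring

end Assembly

end Literature.NumberTheory.EllipticCurves.ModularForms
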